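import Mathlib.MeasureTheory.Constructions.Pi
import Mathlib.MeasureTheory.MeasurableSpace.Embedding
import Mathlib.MeasureTheory.Measure.Haar.InnerProductSpace
import HarnessLib

/-!
# Route `SwapVirialDeficit` (YangMills): quantitative Laplace method — CURRYING IS MEASURE PRESERVING for finite product measures
# (the missing Mathlib brick for W3's `GnoCoord` fibre∕base `MeasurableEquiv`)

Width seat `ym-line-sfw-p2-w2` g58 (cell ym-idea-1, free hands), `--supports stmt-QuantumFields-24197`.  The fibred cores of this seat integrate the fibre over a
EUCLIDEAN space `V` with its inner-product `volume`; the model's fibre coordinates live in `GnoCoord L = ((Fin 3 → ℝ) × (Fin 3 → ℝ)) × (Fin 3 → ℝ) × (Fol L → Fin 3 → ℝ)`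
(product Lebesgue measure).  Mathlib has the measure-preserving reindexings `piCongrLeft`, `sumPiEquivProdPi`, `piEquivPiSubtypeProd`, `piFinSuccAbove`, `prodAssoc` and
`PiLp.volume_preserving_ofLp ∕ toLp` (`EuclideanSpace ℝ ι ≃ (ι → ℝ)`), but NOT the currying step `(ι × κ → X) ≃ (ι → κ → X)`; this file supplies it.

* §1 ★★ `pi_map_curry` — `(⨂_{ι×κ} μ) ∘ curry⁻¹ = ⨂_ι (⨂_κ μ)` for a σ-finite `μ` and finite `ι`, `κ` (rectangles of boxes generate; ✓`Measure.pi_eq_generateFrom`);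
  ★★ `measurePreserving_curry` ∕ `measurePreserving_uncurry`; `volume_preserving_curry` ∕ `volume_preserving_uncurry` (`MeasureSpace X`, σ-finite volume).
* §2 ★ `volume_preserving_euclidean_curry` — `EuclideanSpace ℝ (ι × κ) → (ι → κ → ℝ)`, `y ↦ (i ↦ k ↦ y (i,k))`, preserves volume (compose with ✓`PiLp.volume_preserving_ofLp`):
  the follower block `Fol L → Fin 3 → ℝ` of `GnoCoord L` read in the Euclidean space `EuclideanSpace ℝ (Fol L × Fin 3)`.

HONEST FRAMING: generic measure theory; no model object appears; ⟨24197⟩ `SwapGluedStiffness`, ⟨24196⟩, ⟨22884⟩ stay OPEN; no stub ∕ crux ∕ rung ∕ summit is closed; the Yang–Mills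
mass gap is NOT proved; no summit is proved by a line.  0 definitions, 0 `sorry`, standard axioms.  References: [folklore] (Fubini–Tonelli ∕ uniqueness of product measures).
-/

set_option linter.style.longLine false
set_option linter.style.longFile 0
set_option linter.unusedSectionVars false

noncomputable section

open _root_.MeasureTheory _root_.Set _root_.MeasureTheory.Measure
open scoped _root_.ENNReal

namespace Summit.QuantumFields.YangMills.Theorems.QuantitativeLaplace

/-! ### §1 Currying a finite product measure -/

section Curry

variable {ι κ X : Type*} [Fintype ι] [Fintype κ] [MeasurableSpace X]

/-- The preimage of a rectangle of boxes under currying is a box. [folklore] -/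
theorem curry_preimage_pi_pi (t : ι → κ → Set X) :
    (MeasurableEquiv.curry ι κ X) ⁻¹' (Set.pi univ fun i => Set.pi univ (t i)) = Set.pi univ fun p : ι × κ => t p.1 p.2 := by
  ext f
  simp only [mem_preimage, mem_univ_pi, MeasurableEquiv.coe_curry, Function.curry_apply, Prod.forall]

/-- ★★ **Currying maps the product measure over `ι × κ` to the iterated product measure**: `(⨂_{ι×κ} μ) ∘ curry⁻¹ = ⨂_ι (⨂_κ μ)` (`μ` σ-finite). [folklore] -/
theorem pi_map_curry (μ : Measure X) [SigmaFinite μ] :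
    (Measure.pi fun _ : ι × κ => μ).map (MeasurableEquiv.curry ι κ X) = Measure.pi fun _ : ι => Measure.pi fun _ : κ => μ := by
  symm
  refine pi_eq_generateFrom (C := fun _ : ι => Set.pi univ '' Set.pi univ fun _ : κ => {s : Set X | MeasurableSet s})
    (fun _ => generateFrom_pi) (fun _ => isPiSystem_pi) (fun _ => FiniteSpanningSetsIn.pi fun _ => μ.toFiniteSpanningSetsIn) ?_
  intro s hs
  -- every side is a box `s i = pi univ (t i)` with measurable `t i k`
  have hs' : ∀ i, ∃ t : κ → Set X, (∀ k, MeasurableSet (t k)) ∧ Set.pi univ t = s i := fun i => by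
    obtain ⟨t, ht, hts⟩ := hs i
    exact ⟨t, fun k => (mem_univ_pi.1 ht) k, hts⟩
  choose t ht hts using hs'
  have hseq : (Set.pi univ s) = Set.pi univ fun i => Set.pi univ (t i) := by
    congr 1; funext i; exact (hts i).symm
  have hbox : MeasurableSet (Set.pi univ fun p : ι × κ => t p.1 p.2) := MeasurableSet.univ_pi fun p => ht p.1 p.2
  have hrect : MeasurableSet (Set.pi univ fun i => Set.pi univ (t i)) :=
    MeasurableSet.univ_pi fun i => MeasurableSet.univ_pi fun k => ht i k
  rw [hseq, Measure.map_apply (MeasurableEquiv.curry ι κ X).measurable hrect, curry_preimage_pi_pi, Measure.pi_pi]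
  simp_rw [← hts, Measure.pi_pi]
  exact Fintype.prod_prod_type' (fun i k => μ (t i k))

/-- ★★ **Currying is measure preserving** between `⨂_{ι×κ} μ` and `⨂_ι ⨂_κ μ`. [folklore] -/
theorem measurePreserving_curry (μ : Measure X) [SigmaFinite μ] :
    MeasurePreserving (MeasurableEquiv.curry ι κ X) (Measure.pi fun _ : ι × κ => μ) (Measure.pi fun _ : ι => Measure.pi fun _ : κ => μ) :=
  ⟨(MeasurableEquiv.curry ι κ X).measurable, pi_map_curry μ⟩

/-- ★ **Uncurrying is measure preserving.** [folklore] -/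
theorem measurePreserving_uncurry (μ : Measure X) [SigmaFinite μ] :
    MeasurePreserving (MeasurableEquiv.curry ι κ X).symm (Measure.pi fun _ : ι => Measure.pi fun _ : κ => μ) (Measure.pi fun _ : ι × κ => μ) :=
  (measurePreserving_curry μ).symm _

end Curry

section CurryVolume

variable {ι κ X : Type*} [Fintype ι] [Fintype κ] [MeasureSpace X] [SigmaFinite (volume : Measure X)]

/-- ★ **Currying preserves volume** (`MeasureSpace X` with σ-finite volume; volume on function types is the product volume). [folklore] -/
theorem volume_preserving_curry :
    MeasurePreserving (MeasurableEquiv.curry ι κ X) volume volume := by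
  have h := measurePreserving_curry (ι := ι) (κ := κ) (volume : Measure X)
  simpa only [volume_pi] using h

/-- ★ **Uncurrying preserves volume.** [folklore] -/
theorem volume_preserving_uncurry :
    MeasurePreserving (MeasurableEquiv.curry ι κ X).symm volume volume :=
  (volume_preserving_curry (ι := ι) (κ := κ) (X := X)).symm _

end CurryVolume

/-! ### §2 The Euclidean reading of a doubly indexed block -/

section Euclidean

variable {ι κ : Type*} [Fintype ι] [Fintype κ]

/-- ★ **`EuclideanSpace ℝ (ι × κ) → (ι → κ → ℝ)`, `y ↦ (i ↦ k ↦ y (i, k))`, preserves volume** — a doubly indexed Lebesgue block (e.g. the followers `Fol L → Fin 3 → ℝ` of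
`GnoCoord L`) IS a Euclidean space with its inner-product volume, as the fibred Laplace cores require. [folklore] -/
theorem volume_preserving_euclidean_curry :
    MeasurePreserving (fun y : EuclideanSpace ℝ (ι × κ) => fun i k => y (i, k)) volume volume := by
  have h := (volume_preserving_curry (ι := ι) (κ := κ) (X := ℝ)).comp (PiLp.volume_preserving_ofLp (ι × κ))
  exact h

/-- The same map as a measurable equivalence `EuclideanSpace ℝ (ι × κ) ≃ᵐ (ι → κ → ℝ)` (for images of measurable sets, injectivity, and the inverse direction). [folklore] -/
theorem volume_preserving_euclidean_curry_equiv :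
    MeasurePreserving ((MeasurableEquiv.toLp 2 (ι × κ → ℝ)).symm.trans (MeasurableEquiv.curry ι κ ℝ)) volume volume :=
  (volume_preserving_curry (ι := ι) (κ := κ) (X := ℝ)).comp (PiLp.volume_preserving_ofLp (ι × κ))

end Euclidean

end Summit.QuantumFields.YangMills.Theorems.QuantitativeLaplace

end
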